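import Summits.Ventures.LatticeQCDFlow.Exactness.FlowSamplerSquareIntegrableContraction
import HarnessLib

/-!
# The exact flow sampler is a POSITIVE operator on all of `L²(e^{−S})`: `⟨f, K f⟩ = ∫_{u>0} (∫ 1[u < w/q̃] f q̃)² du + ∫ f² w r ≥ ∫ f² w r ≥ 0`

HONEST FRAMING: exact (Metropolis-corrected) sampling algorithms for lattice gauge theory;
figures of merit are autocorrelation/cost numbers at stated couplings and volumes; no
continuum-physics claim.  (SCALAR calibration rung S0-A: not a gauge result.)

Venture `LatticeQCDFlow` (cell pub-lqcd), topic `Exactness`; FANOUT row 2 (`s0-phi4`, FLOW arm: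
independence Metropolis `K = imhOp μ w q̃`).  NEW WORK of the cell: the layer-cake representation of
`Exactness/FlowSamplerPositive.lean` (bounded observables) re-proved on the class of measurable
SQUARE-INTEGRABLE observables, with the triple Fubini dominated by `f² w ⊗ q̃ + q̃ ⊗ f² w` instead of
`B² w ⊗ q̃` (`FlowSamplerSquareIntegrable.imhFlow_mul_abs_mul_abs_le`).  Nothing is cited as a fact.
Printed counterparts NAMED ONLY: Liu 1996 / Liu, *Monte Carlo Strategies* §13.4 Thm 13.4.1 (finite
state space: the Metropolized independence sampler has spectrum `λ_k = E_π(1/w − 1/w_k)⁺ ∈ [0,1)`);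
Gåsemyr 2006, Atchadé–Perron 2007 (positivity of the IMH kernel on general spaces).

## What is proved (general `(X, μ)` s-finite; `w > 0` integrable, `q > 0` measurable integrable with
`∫ q = 1`; "square-integrable" = measurable with `∫ f² w < ∞`; `s = min(w q', w' q)`,
`r(t) = ∫ (1 − α(t,t')) q(t') dt'` the rejection probability)

* **`integral_integral_imhFlow_eq_sq_of_sq`** — `∫∫ s(t,t') f(t') f(t) = ∫_{u>0} (∫ 1[u < w/q] f q)² du`
  for square-integrable `f` (the `min` kernel in the importance ratio is positive semidefinite on
  `L²(w)`);
* **`integral_mul_imhOp_mul_eq_of_sq`** — `∫ f (K f) w = ∫_{u>0} (∫ 1[u<w/q] f q)² du + ∫ f² w r`;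
* **`integral_sq_mul_rejection_le_of_sq`** — THE STICKING FLOOR `∫ f² w r ≤ ∫ f (K f) w` (lag one:
  `C_f(1) ≥ E_w[r f²]` for every square-integrable `f`, e.g. the centred magnetisation);
* **`integral_mul_imhOp_mul_nonneg_of_sq`** — (pos): `0 ≤ ∫ f (K f) w` for every square-integrable `f`.

With `FlowSamplerSquareIntegrable` / `…Contraction` the exact flow sampler is an instance of the
tree's `RevOp` format WITH (pos) on the square-integrable class; the consequences (monotone, convex,
log-convex autocovariances of the magnetisation itself; `τ_int ≥ ½ + ρ(1)`; every window a floor;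
cross-observable tunnelling floors for `M`) are `FlowSamplerSquareIntegrableMonotone.lean` and the
lattice file `Phi4FlowSquareIntegrable.lean`.
NOT CLAIMED: anything for non-square-integrable observables; any number for a trained network.
-/

namespace Summit.Ventures.LatticeQCDFlow.Exactness

open Real MeasureTheory Filter Finset Set

section General

variable {X : Type*} [MeasurableSpace X] {μ : Measure X} [SFinite μ] {w q : X → ℝ}

/-- **THE OFF-DIAGONAL FORM IS A SQUARE INTEGRAL ON `L²(w)` (layer cake).**  For measurable
square-integrable `f`: `∫∫ s(t,t') f(t') f(t) dμ dμ = ∫_{u>0} (∫ 1[u < w/q] · f · q dμ)² du`. -/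
theorem integral_integral_imhFlow_eq_sq_of_sq (hw0 : ∀ t, 0 < w t) (hwm : Measurable w)
    (hq0 : ∀ t, 0 < q t) (hqm : Measurable q) (hqi : Integrable q μ)
    {f : X → ℝ} (hfm : Measurable f) (hf2 : Integrable (fun t => f t ^ 2 * w t) μ) :
    ∫ t, ∫ t', imhFlow w q t t' * f t' * f t ∂μ ∂μ
      = ∫ u in Ioi (0:ℝ), (∫ t, (if u < w t / q t then f t * q t else 0) ∂μ) ^ 2 := by
  set ν : Measure ℝ := volume.restrict (Ioi 0) with hν
  -- the cut-off observable `c u t = 1[u < b t] f t q t`, jointly measurable in `(t, u)`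
  set c : ℝ → X → ℝ := fun u t => if u < w t / q t then f t * q t else 0 with hc
  have hbm : Measurable fun t => w t / q t := hwm.div hqm
  have hb0 : ∀ t, 0 < w t / q t := fun t => div_pos (hw0 t) (hq0 t)
  have hcm : Measurable fun z : X × ℝ => c z.2 z.1 := by
    simp only [hc]
    exact Measurable.ite (measurableSet_lt measurable_snd (hbm.comp measurable_fst))
      ((hfm.mul hqm).comp measurable_fst) measurable_const
  -- the integrand on `(X × X) × ℝ`
  have hFm : Measurable fun z : (X × X) × ℝ => c z.2 z.1.1 * c z.2 z.1.2 :=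
    (hcm.comp ((measurable_fst.comp measurable_fst).prodMk measurable_snd)).mul
      (hcm.comp ((measurable_snd.comp measurable_fst).prodMk measurable_snd))
  -- pointwise in `(t, t')`: the `u`-integral of the product of cut-offs is the flow term
  have hprod_eq : ∀ (u : ℝ) (t t' : X), c u t * c u t'
      = if u < min (w t / q t) (w t' / q t') then f t * q t * (f t' * q t') else 0 := by
    intro u t t'
    simp only [hc]
    exact ite_lt_mul_ite_lt u _ _ _ _
  have hmin0 : ∀ t t', 0 ≤ min (w t / q t) (w t' / q t') := fun t t' =>
    le_min (hb0 t).le (hb0 t').le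
  have hF_eq : ∀ t t', ∫ u, c u t * c u t' ∂ν = imhFlow w q t t' * f t' * f t := by
    intro t t'
    simp_rw [hprod_eq]
    rw [hν, integral_Ioi_ite_lt (hmin0 t t'), imhFlow_eq_mul_min hq0]
    ring
  have hnorm_eq : ∀ t t', ∫ u, ‖c u t * c u t'‖ ∂ν
      = imhFlow w q t t' * |f t'| * |f t| := by
    intro t t'
    have e : ∀ u, ‖c u t * c u t'‖
        = if u < min (w t / q t) (w t' / q t') then |f t| * q t * (|f t'| * q t') else 0 := by
      intro u
      rw [hprod_eq, Real.norm_eq_abs]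
      split_ifs
      · rw [abs_mul, abs_mul, abs_mul, abs_of_pos (hq0 t), abs_of_pos (hq0 t')]
      · exact abs_zero
    simp_rw [e]
    rw [hν, integral_Ioi_ite_lt (hmin0 t t'), imhFlow_eq_mul_min hq0]
    ring
  -- integrability on the triple product: dominated by `f² w ⊗ q + q ⊗ f² w`
  have hFint : Integrable (fun z : (X × X) × ℝ => c z.2 z.1.1 * c z.2 z.1.2) ((μ.prod μ).prod ν) := by
    rw [integrable_prod_iff hFm.aestronglyMeasurable]
    constructor
    · refine Eventually.of_forall fun p => ?_
      have e : (fun u => c u p.1 * c u p.2)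
          = (Iio (min (w p.1 / q p.1) (w p.2 / q p.2))).indicator
              (fun _ => f p.1 * q p.1 * (f p.2 * q p.2)) := by
        funext u
        rw [hprod_eq]
        simp only [Set.indicator, Set.mem_Iio]
      rw [e, integrable_indicator_iff measurableSet_Iio]
      refine integrableOn_const ?_
      rw [hν, Measure.restrict_apply measurableSet_Iio, Iio_inter_Ioi, Real.volume_Ioo]
      exact ENNReal.ofReal_ne_top
    · have e : (fun p : X × X => ∫ u, ‖c u p.1 * c u p.2‖ ∂ν)
          = fun p => imhFlow w q p.1 p.2 * |f p.2| * |f p.1| := by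
        funext p
        exact hnorm_eq p.1 p.2
      rw [e]
      have hD : Integrable (fun p : X × X => f p.1 ^ 2 * w p.1 * q p.2 + q p.1 * (f p.2 ^ 2 * w p.2))
          (μ.prod μ) := (hf2.mul_prod hqi).add (hqi.mul_prod hf2)
      refine Integrable.mono' hD
        ((((measurable_imhFlow hwm hqm).mul
          (continuous_abs.measurable.comp (hfm.comp measurable_snd))).mul
          (continuous_abs.measurable.comp (hfm.comp measurable_fst)))).aestronglyMeasurable
        (Eventually.of_forall fun p => ?_)
      rw [Real.norm_eq_abs, abs_of_nonneg (mul_nonneg (mul_nonneg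
        (imhFlow_nonneg_le hw0 hq0 p.1 p.2).1 (abs_nonneg _)) (abs_nonneg _))]
      exact imhFlow_mul_abs_mul_abs_le hw0 hq0 f f p.1 p.2
  -- Fubini: `∫_t ∫_t' ∫_u = ∫_{(t,t')} ∫_u = ∫_u ∫_{(t,t')} = ∫_u (∫_t c)(∫_t' c)`
  calc ∫ t, ∫ t', imhFlow w q t t' * f t' * f t ∂μ ∂μ
      = ∫ t, ∫ t', ∫ u, c u t * c u t' ∂ν ∂μ ∂μ := by
        simp_rw [hF_eq]
    _ = ∫ p, ∫ u, c u p.1 * c u p.2 ∂ν ∂(μ.prod μ) :=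
        (integral_prod (fun p : X × X => ∫ u, c u p.1 * c u p.2 ∂ν) hFint.integral_prod_left).symm
    _ = ∫ u, ∫ p, c u p.1 * c u p.2 ∂(μ.prod μ) ∂ν :=
        integral_integral_swap (f := fun (p : X × X) (u : ℝ) => c u p.1 * c u p.2) hFint
    _ = ∫ u, (∫ t, c u t ∂μ) ^ 2 ∂ν := by
        refine integral_congr_ae (Eventually.of_forall fun u => ?_)
        dsimp only
        rw [sq]
        exact integral_prod_mul (fun t => c u t) (fun t => c u t)

/-- **`⟨f, K f⟩_w` DECOMPOSED on `L²(w)`**: for every measurable square-integrable `f`,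
`∫ f (K f) w dμ = ∫_{u>0} (∫ 1[u < w/q] f q dμ)² du + ∫ f² w r dμ`. -/
theorem integral_mul_imhOp_mul_eq_of_sq (hw0 : ∀ t, 0 < w t) (hwm : Measurable w)
    (hwi : Integrable w μ) (hq0 : ∀ t, 0 < q t) (hqm : Measurable q) (hqi : Integrable q μ)
    (hq1 : ∫ t, q t ∂μ = 1) {f : X → ℝ} (hfm : Measurable f)
    (hf2 : Integrable (fun t => f t ^ 2 * w t) μ) :
    ∫ t, f t * imhOp μ w q f t * w t ∂μ
      = (∫ u in Ioi (0:ℝ), (∫ t, (if u < w t / q t then f t * q t else 0) ∂μ) ^ 2)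
        + ∫ t, f t ^ 2 * w t * (∫ t', (1 - imhAcceptQ w q t t') * q t' ∂μ) ∂μ := by
  obtain ⟨hr0, hr1, hrm⟩ := rejection_bounds (μ := μ) hw0 hwm hq0 hqm hqi hq1
  have hfw := integrable_mul_weight_of_sq (fun t => (hw0 t).le) hwm hwi hfm hf2
  have hpt : ∀ t, f t * imhOp μ w q f t * w t
      = (∫ t', imhFlow w q t t' * f t' * f t ∂μ)
        + f t ^ 2 * w t * ∫ t', (1 - imhAcceptQ w q t t') * q t' ∂μ := by
    intro t
    have e := imhOp_mul_mul_weight_eq hw0 hwm hq0 hqm hqi hfm hfw t (f t)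
    calc f t * imhOp μ w q f t * w t = imhOp μ w q f t * f t * w t := by ring
      _ = (∫ t', imhFlow w q t t' * f t' * f t ∂μ)
          + f t * f t * w t * ∫ t', (1 - imhAcceptQ w q t t') * q t' ∂μ := e
      _ = _ := by ring
  have hI1 : Integrable (fun t => ∫ t', imhFlow w q t t' * f t' * f t ∂μ) μ :=
    (integrable_imhFlow_mul_mul_of_sq hw0 hwm hq0 hqm hqi hfm hfm hf2 hf2).integral_prod_left
  have hI2 : Integrable (fun t => f t ^ 2 * w t * ∫ t', (1 - imhAcceptQ w q t t') * q t' ∂μ) μ := by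
    refine Integrable.mono' hf2 (((hfm.pow_const 2).mul hwm).mul hrm).aestronglyMeasurable
      (Eventually.of_forall fun t => ?_)
    rw [Real.norm_eq_abs, abs_mul, abs_of_nonneg (mul_nonneg (sq_nonneg _) (hw0 t).le),
      abs_of_nonneg (hr0 t)]
    exact mul_le_of_le_one_right (mul_nonneg (sq_nonneg _) (hw0 t).le) (hr1 t)
  rw [integral_congr_ae (Eventually.of_forall hpt), integral_add hI1 hI2,
    integral_integral_imhFlow_eq_sq_of_sq hw0 hwm hq0 hqm hqi hfm hf2]

/-- **THE STICKING FLOOR ON `L²(w)`**: `∫ f² w r dμ ≤ ∫ f (K f) w dμ` — at lag one the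
autocovariance of every square-integrable observable is at least the rejection-weighted second
moment (for the centred magnetisation: `C_M(1) ≥ E[r · (M − ⟨M⟩)²]`). -/
theorem integral_sq_mul_rejection_le_of_sq (hw0 : ∀ t, 0 < w t) (hwm : Measurable w)
    (hwi : Integrable w μ) (hq0 : ∀ t, 0 < q t) (hqm : Measurable q) (hqi : Integrable q μ)
    (hq1 : ∫ t, q t ∂μ = 1) {f : X → ℝ} (hfm : Measurable f)
    (hf2 : Integrable (fun t => f t ^ 2 * w t) μ) :
    ∫ t, f t ^ 2 * w t * (∫ t', (1 - imhAcceptQ w q t t') * q t' ∂μ) ∂μ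
      ≤ ∫ t, f t * imhOp μ w q f t * w t ∂μ := by
  rw [integral_mul_imhOp_mul_eq_of_sq hw0 hwm hwi hq0 hqm hqi hq1 hfm hf2]
  have h : 0 ≤ ∫ u in Ioi (0:ℝ), (∫ t, (if u < w t / q t then f t * q t else 0) ∂μ) ^ 2 :=
    integral_nonneg fun u => sq_nonneg _
  linarith

/-- **THE INDEPENDENCE SAMPLER IS A POSITIVE OPERATOR ON ALL OF `L²(w dμ)`**: `0 ≤ ∫ f (K f) w dμ`
for every measurable square-integrable `f` (no centring, no boundedness, no hypothesis on the
model density beyond positivity and `∫ q̃ = 1`). -/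
theorem integral_mul_imhOp_mul_nonneg_of_sq (hw0 : ∀ t, 0 < w t) (hwm : Measurable w)
    (hwi : Integrable w μ) (hq0 : ∀ t, 0 < q t) (hqm : Measurable q) (hqi : Integrable q μ)
    (hq1 : ∫ t, q t ∂μ = 1) {f : X → ℝ} (hfm : Measurable f)
    (hf2 : Integrable (fun t => f t ^ 2 * w t) μ) :
    0 ≤ ∫ t, f t * imhOp μ w q f t * w t ∂μ := by
  obtain ⟨hr0, -, -⟩ := rejection_bounds (μ := μ) hw0 hwm hq0 hqm hqi hq1
  refine le_trans (integral_nonneg fun t => ?_)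
    (integral_sq_mul_rejection_le_of_sq hw0 hwm hwi hq0 hqm hqi hq1 hfm hf2)
  exact mul_nonneg (mul_nonneg (sq_nonneg _) (hw0 t).le) (hr0 t)

end General

end Summit.Ventures.LatticeQCDFlow.Exactness
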